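import Mathlib
import HarnessLib
import HarnessLib.Audit
import Summits.PneNP.Statement
import Literature.ModelTheory.FiniteModelTheory.ESOPrefixClasses
import Literature.ModelTheory.FiniteModelTheory.GeneralizedSpectraComplement
import Literature.ModelTheory.FiniteModelTheory.NonThreeColUniversalPrefix
import Literature.Computability.Complexity.CookBridges
import HarnessLib.Audit.Status.Attr

/-!
Route: NonThreeColCutRectangles

DORMANT since 2026-08-29T19:39:58Z (census g0: costume|duplicate of route-PneNP-AeaCutRectangles; reader census-reader-59-g0) — unstaffed, not closed; items shared with open routes are served there. `ledger route dormant <id> --off` reactivates.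

# Route NonThreeColCutRectangles — Non-3-colourability escapes ESO(∃*∀∃∀) via Skolem-cut rectangle
covers — the order-free ∀∃∀ rung of Fagin's generalized-spectrum ladder

It suffices to show X = X1 ∧ R. X1 (ATTACKED, rank 2, `NonThreeColNotAEA`): the class 𝒩 of finite
graphs that are
NOT 3-colourable (inputs = all binary tables on [n], read as loop-free symmetrised graphs — Fagin's
convention) is
not definable by any existential second-order sentence ∃R̄ ∃c̄ ∀x∃y∀z θ (witness relations R̄ of ANY
arities, any
number p of leading first-order existentials c̄, θ quantifier-free): 𝒩 ∉ ESO(∃*∀∃∀). R (declared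
RESIDUAL, rank 3,
`PrefixClimb`): X1 → 𝒩 is not a generalized spectrum at all (¬ IsESODefinable [2] 𝒩, the negative
answer to Fagin's
generalized Asser problem). X1 ∧ R is the top of Fagin's ladder, equivalent to NP ≠ coNP (Fagin1993
Thms 5.2–5.3; the
direction used is PROVED in the tree, `NP_ne_coNP_of_not_isESODefinable_nonThreeColClass`), hence P
≠ NP. Realises
the mwave sketch `non3col-eso-cut-rectangles` (reader verdict PASS); no idea card.
Lean: `(¬ Literature.ModelTheory.FiniteModelTheory.IsPrefixDefinable [2]
[Literature.ModelTheory.FiniteModelTheory.FOQuant.all,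
Literature.ModelTheory.FiniteModelTheory.FOQuant.ex,
Literature.ModelTheory.FiniteModelTheory.FOQuant.all]
Literature.ModelTheory.FiniteModelTheory.nonThreeColClass) ∧ ((¬
Literature.ModelTheory.FiniteModelTheory.IsPrefixDefinable [2]
[Literature.ModelTheory.FiniteModelTheory.FOQuant.all,
Literature.ModelTheory.FiniteModelTheory.FOQuant.ex,
Literature.ModelTheory.FiniteModelTheory.FOQuant.all]
Literature.ModelTheory.FiniteModelTheory.nonThreeColClass) → ¬
Literature.ModelTheory.FiniteModelTheory.IsESODefinable [2]
Literature.ModelTheory.FiniteModelTheory.nonThreeColClass)`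

## Assembly
Pure logic plus two PROVED tree facts, inside glue.lean (`closes` proves the `Assembly` item and
applies it): from X1 and R get
`¬ IsESODefinable [2] nonThreeColClass`; `NP_ne_coNP_of_not_isESODefinable_nonThreeColClass`
(Fagin1993 Thm 5.3, ⇐ direction, landed in
Literature/ModelTheory/FiniteModelTheory/GeneralizedSpectraComplement.lean, p171940: 3-COL ∈ ∃SO by
Fagin's sentence, ∃SO = NP via
`fagin_theorem_holds`, complement closure of generalized spectra under NP = coNP) gives `NP ≠ coNP`;
`co_P_holds` turns `P = NP` into
`NP = coNP`; `pneNP_shape_of_P_ne_NP` (CookBridges) gives the Wave-0 shape `∃ L ∈ NP Bool, L ∉ P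
Bool` = `PneNP`.

Rationale: WHY THIS LINE. Mechanism: Fagin's ladder (Fagin1974, Fagin1993 §§5,7) asks for non-definability of
the coNP-complete class 𝒩 in ever
larger fragments of ∃SO over UNORDERED finite graphs; the monadic rung is classical (Fagin 1975,
AjtaiFagin1990), the
binary rung is open since 1975 (DurandLautemannSchwentick1998 §7), and second-order
Ehrenfeucht–Fraïssé games /
Hanf–Gaifman locality stop at the first prefix class that contains CONN and HAM, which is ∃*∀∃∀
(GottlobKolaitisSchwentick2004 Thm 2.7; EiterGottlobGurevich2000 for the string side). The line
attacks exactly that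
class with a tool imported from communication complexity and picture languages: the single unary
Skolem function f of
∀x∃y∀z has near-bisection CUTS with O(1) leaks (cut lemma), every "key" of a model w.r.t. a cut
spans a combinatorial
RECTANGLE of edge tables inside the defined class (hybrid lemma), so every ESO(∃*∀∃∀)-class has
near-bisection
rectangle covers of size 2^{(1/2) n log₂ n + O(n)}; a FOOLING MEASURE on 𝒩_n giving every such
rectangle mass
2^{-(1/2) n log₂ n - ω(n)} (e.g. uniform on the transversal graphs of a spread defect system) then
proves X1
(KushilevitzNisan1996 ch. 2 rectangles / fooling sets; the Giammarresi–Restivo–Matz cut technique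
for tiling-recognisable
picture languages, transplanted through the Skolem cut). Imported: extremal combinatorics +
nondeterministic
communication complexity into finite model theory. What it does that prior routes / the negatives
index do not: no open,
draft or closed PneNP route carries an ESO-definability lower bound for 𝒩 or any rung of the
arity/prefix ladder
(route-PneNP-Descriptive is the capture-of-P side and only DEFINES the Fagin vocabulary this route
reuses;
route-PneNP-NtimeComplementLadder was the machine-time column of the same NP ≠ coNP circle, retired
summit-strength
today); the 6 negatives of the summit are unrelated (circuits, proof complexity, PMF gaps,
Diophantine sums).
Honest position: X1 is a necessary condition of NP ≠ coNP, far below it, with PROVED neighbours (𝒩 ∉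
ESO(∃*∀*), landed
this session as the BC5 rung
`Literature.ModelTheory.FiniteModelTheory.nonThreeColClass_not_isPrefixDefinable_forall`, p172718; 𝒩
∉ ESO(∃*∀∃*) on paper); R is dominated by NP ≠ coNP and is declared residual — the
route is a FRONTIER ladder (BC9), not a distance-to-summit claim.

RANKED CRUXES. #2 NonThreeColNotAEA (crux) — 𝒩 ∉ ESO(∃*∀∃∀): no existential second-order sentence
over the graph vocabulary [2] with witness relations of any arities, p leading first-order
existential quantifiers and first-order prefix ∀∃∀ over a quantifier-free matrix has model class
equal to the class of binary tables whose symmetrised loop-free graph is not 3-colourable (sketch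
item X1; `IsPrefixDefinable`, `nonThreeColClass` landed in
Literature/ModelTheory/FiniteModelTheory/ESOPrefixClasses.lean, p171860). [difficulty: XL] (why it
might fail: False only if NP = coNP; the risk is true-but-unreachable: the fooling measure (★★) /
spread defect systems (♣) may not exist — 𝒩 could be compressible across some near-bisection for
every measure — and the (1/2)·n·log₂ n threshold is intrinsic (HAM ∈ ESO(∀∃∀)), leaving no slack.)
[Fagin1993, GottlobKolaitisSchwentick2004, EiterGottlobGurevich2000, DurandLautemannSchwentick1998,
KushilevitzNisan1996, AjtaiFagin1990]
#3 PrefixClimb (crux) — RESIDUAL (declared T1′ complement, not claimed attackable): if 𝒩 escapes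
ESO(∃*∀∃∀) then 𝒩 is not a generalized spectrum about graphs at all — for every list of witness
arities no ∃SO sentence defines 𝒩 (negative answer to Fagin's generalized Asser problem, Fagin1993
p.12); contrapositively NP = coNP ⇒ 𝒩 ∈ ESO(∃*∀∃∀). [deps: NonThreeColNotAEA] [difficulty:
open-problem] (why it might fail: Dominated by NP ≠ coNP (NP ≠ coNP ⇒ 𝒩 ∉ ∃SO by Fagin1993 Thm 5.3 ⇒
R): summit-strength, declared residual; the binary rung (one extra binary relation, arbitrary FO
part) has had no technique since 1975 (DurandLautemannSchwentick1998 §7).) [Fagin1993, Fagin1974,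
DurandLautemannSchwentick1998, arXiv:0907.5495]

TWO-LAYER PLAN. Foreseen glued split of NonThreeColNotAEA once a door moves (registered as the birth
skeleton, NOT filed as items):
NonThreeColNotAEA ⇐ RectangleCoverAEA → FoolingMeasureAEA → NonThreeColNotAEA (proved in
Lines/birth.lean: union bound over the cover
against the fooling measure, 2^{c n} · 2^{-C n} < 1). RectangleCoverAEA = every ESO(∃*∀∃∀)-class
has, for every ε ∈ (0,1/4], eventually
near-bisection rectangle covers of size ≤ 2^{(1/2) n log₂ n + c n} (cut lemma + hybrid lemma; proved
on paper, L-sized formalisation);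
FoolingMeasureAEA = for some ε and every C, infinitely often a probability measure on 𝒩_n giving
every near-bisection rectangle inside 𝒩
mass ≤ 2^{-(1/2) n log₂ n - C n} (OPEN — the brick; door (♣) spread defect systems ⇒ it with μ
uniform on transversal graphs).

KILL CRITERIA. Refutation of NonThreeColNotAEA (a concrete ESO(∃*∀∃∀) sentence defining 𝒩 — this
would prove NP = coNP) closes the route
`refuted:NonThreeColNotAEA`. A proof of ¬FoolingMeasureAEA ("every measure on 𝒩_n has a heavy
near-bisection rectangle", equivalently
2^{(1/2) n log₂ n + O(n)} cut-rectangle covers of 𝒩_n) kills the LINE (birth skeleton), not the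
crux: pivot to a third method or retire
`exhausted` with the compressibility theorem banked. A proof of NP ≠ coNP elsewhere moots the route
(it implies both items); a proof that
NP = coNP refutes X1.

NOT DECOMPOSED YET. The doors of X1 — (♣) spread defect systems (two-piercing Kneser template; dense
planted near-tripartite families), (★★) the fooling
measure directly (information cost uniform over near-bisections), and the refutation door ¬(★★) —
are LINES on the crux (skeleton stubs),
not items; the cut lemma, hybrid lemma and cover counting are stub-level lemmas of
`stub_rectangleCover`. The higher rungs (∀∀∃, Lynch's
L₂, binary NP, built-in arithmetic on the monadic axis) sit inside the residual and are never
staffed. Constants (ε ≤ 1/4, the O(n) slack)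
are fixed only inside the skeleton.

CHEAPEST FALSIFIER. (k1) Referee the rectangle-cover theorem's end-accounting (cut lemma leak bound
|L(B)|+|X(B)| ≤ 3 and the hybrid lemma) — a one-day read; a
gap changes X1's reduction, not X1. (k2) Try to prove ¬FoolingMeasureAEA from "every G ∈ 𝒩 contains
a 4-critical subgraph" plus the
necessary-condition map (α < (1/2-ε)n, m ≥ (4/3) n log₂ n, 2^{ω(n)} isomorphism types, no spectral
certificate): success kills the line and
is a publishable compressibility theorem for non-3-colourability. (k3) In Lean, already run this
session: the ∃*∀* rung
`nonThreeCol_not_existsForall` (odd wheels + universal preservation) went through sorry-free — the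
semantics of `IsPrefixDefinable` is
exercised non-vacuously on the negative side; the positive calibration (EVEN, HAM ∈ ESO(∀∃∀)) is the
next cheap check of the typing.

NUMBERS. Cover size per near-bisection cut: 2^{(1/2) n log₂ n + O(n)} keys (cut lemma: |B| ∈ [n/4,
n/2], ≤ 3 leaks for one unary f on n ≥ 4
points); the threshold (1/2) n log₂ n is intrinsic — HAM ∈ ESO(∀∃∀) saturates it. Fixed-cut
truncation: Θ(n²) split pairs for ONE prescribed
bisection (Toft-type dense 4-critical hosts) vs (1/2+ε) n log₂ n needed for EVERY near-bisection
simultaneously. BC5 rung: for prefix ∃^p∀^q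
the odd wheel W_{2p+3} (2p+4 vertices) defeats every sentence — p+1 ≤ 2p+2 < 2p+3 rim vertices can
be named, one rim vertex is always missed.

DEFINITION REQUESTS. None outstanding. Landed this session as T0 Literature (cited Fagin1993):
`FOQuant`, `FOQuant.closePrefix`, `ESOSentence.ofPrefix`,
`IsPrefixDefinable`, `tablesOfAdj`/`graphOfTables`, `threeColClass`/`nonThreeColClass`
(ESOPrefixClasses.lean, p171860);
`isESODefinable_threeColClass`, `isESODefinable_compl_of_NP_eq_coNP`,
`NP_ne_coNP_of_not_isESODefinable_nonThreeColClass` and the named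
fact `nonThreeCol_genSpectrum_iff_NP_eq_coNP` (Fagin1993 Thms 5.2/5.3, ⇒ direction needs
NP-completeness of 3-COL in the table encoding)
(GeneralizedSpectraComplement.lean, p171940).

Novelty: Searches (2026-08-17, this seat + the sketch seat, both corpora): `lit search --hybrid
"non-3-colorable graphs not definable existential second-order prefix class lower bound"` (8 docs:
STACS'01, Esparza–Michaux–Steinhorn FAMT 2011
[corpus:book:esparza2011-finite-algorithmic-model-theory pp.20,220,252], Beckmann CiE'06 — surveys
of prefix-class COMPLEXITY, no expressiveness lower bound for 𝒩); `lit vsearch "<X1 in prose>" -k 8`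
([corpus:book:libkinnd-elements-finite-model-theory pp.132,137,194] monadic NP / games — nothing at
∀∃∀ with arbitrary arity); sketch seat same day: `lit search --hybrid "binary NP existential
second-order binary relation symbols graph property not definable lower bound"` (12 docs, none),
`lit search '"binary NP"' --source all` ([corpus:paper:arxiv-1912.00010 p.4],
[corpus:paper:doi-10-1007-bfb0028015 p.12] = the open problem; DLS98 via zbMATH), `lit search
'"tractability frontier" existential second-order graphs' --source all`
([corpus:paper:doi-10-1145-972639-972646] GKS04, [corpus:paper:arxiv-1412.6396] Tantau 2015,
[corpus:paper:arxiv-2310.01134]), `lit search "arity hierarchy existential second-order logic strict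
graphs" --year-from 2010` ([corpus:paper:arxiv-1502.05632 pp.3,32]), `lit galaxy search --star all`
"binary NP|monadic NP|generalized spectra|generalized spectrum" (62 rows, textbooks/surveys),
"monadic NP" (40 rows), "Ajtai-Fagin game" (11 rows), `lit galaxy read panama:103560251441238`
([galaxy:panama:103560251441238] Grädel–Kolaitis–Li  [refs: book:esparza2011-finite-algorithmic-model-theory, book:libkinnd-elements-finite-model-theory, paper:arxiv-1912.00010, paper:doi-10-1007-bfb0028015, paper:doi-10-1145-972639-972646, paper:arxiv-1412.6396, paper:arxiv-2310.01134, paper:arxiv-1502.05632, paper:doi-10-1016-0304-3975-93-90218-i, Fagin1993, Fagin1974, AjtaiFagin1990, DurandLautemannSchwentick1998, GottlobKolaitisSchwentick2004, EiterGot]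

Barriers (technique_class: finite-model-theory, rectangle-cover, fooling-measure): - technique_class: finite-model-theory, rectangle-cover, fooling-measure
- Literature.Barriers.PneNP.Relativization (catalogue A1; with A3
Literature.Barriers.PneNP.BoundedRelativization and A44 thin oracles): OUTSIDE — X1 is a
definability statement on finite unordered graphs with NO built-in relations (the descriptive
analogue of oracles/advice is built-in relations, which X1 does not admit), proved — if at all — by
an input-specific fooling argument, not a simulation or diagonalization; nothing in the line
relativizes because nothing in it is a machine.
- Literature.Barriers.PneNP.Algebrization (catalogue A6/A7): OUTSIDE — no arithmetization or
low-degree extension anywhere in the line.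
- Literature.Barriers.PneNP.NaturalProofs (catalogue A8, with A9/A10): OUTSIDE as typed — the
barrier quantifies over constructive, large properties useful against P/poly-type deterministic
circuit classes computing PRFs; X1 is a lower bound for ONE coNP-complete class against a
NONDETERMINISTIC syntactic class (∋ HAM), via a measure concentrated on specially constructed hard
instances (the fooling-set analogue for nondeterministic protocols), to which no natural-proofs
obstruction is known; caveat recorded: A8 re-enters only if ESO(∃*∀∃∀) is shown to evaluate PRF-hard
deterministic computations on adjacency matrices AND a P/poly-constructive largeness condition is
extracted from the fooling measure — neither is in sight.
- Literature.Barriers.PneNP.KhrapchenkoLimit and Literature.Barriers.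

History (route lifecycle, newest last):
- 2026-08-29T19:39:58Z · DORMANT — census g0: costume|duplicate of route-PneNP-AeaCutRectangles; reader census-reader-59-g0 (operator:999:1583619)

sub-problem: PneNP · status: dormant · opened planner-type-764967f429-0 2026-08-17T18:42:34Z · rev 1 · ledger route-PneNP-NonThreeColCutRectangles
GENERATED by the gate from the ledger (D-0016/17). Provers cite these decls: `theorem foo : Summit.PneNP.PneNP.Theses.NonThreeColCutRectangles.<Decl> := …` in Summits/PneNP/PneNP/Theorems/<Name>.lean.
-/

namespace Summit.PneNP.PneNP.Theses.NonThreeColCutRectangles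

open scoped BigOperators Topology Manifold Classical MeasureTheory ProbabilityTheory Matrix InnerProductSpace ComplexConjugate ContinuousMap
open Filter Set Function TopologicalSpace MeasureTheory

attribute [summit_statement] _root_.PneNP

open Literature.PNP

/-- item stmt-PneNP-19511 · crux · rank 2 · open · by planner
why it might fail: False only if NP = coNP; the risk is true-but-unreachable: the fooling measure (★★) / spread defect systems (♣) may not exist — 𝒩 could be compressible across some near-bisection for every measure — and the (1/2)·n·log₂ n threshold is intrinsic (HAM ∈ ESO(∀∃∀)), leaving no slack.
sources: Fagin1993, GottlobKolaitisSchwentick2004, EiterGottlobGurevich2000, DurandLautemannSchwentick1998, KushilevitzNisan1996, AjtaiFagin1990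
[crux] 𝒩 ∉ ESO(∃*∀∃∀): no existential second-order sentence over the graph vocabulary [2] with
witness relations of any arities, p leading first-order existential quantifiers and first-order
prefix ∀∃∀ over a quantifier-free matrix has model class equal to the class of binary tables whose
symmetrised loop-free graph is not 3-colourable (sketch item X1; `IsPrefixDefinable`,
`nonThreeColClass` landed in Literature/ModelTheory/FiniteModelTheory/ESOPrefixClasses.lean,
p171860). [difficulty: XL] -/
@[route_item "route-PneNP-NonThreeColCutRectangles", crux]
def NonThreeColNotAEA : Prop :=
  ¬ Literature.ModelTheory.FiniteModelTheory.IsPrefixDefinable [2] [Literature.ModelTheory.FiniteModelTheory.FOQuant.all, Literature.ModelTheory.FiniteModelTheory.FOQuant.ex, Literature.ModelTheory.FiniteModelTheory.FOQuant.all] Literature.ModelTheory.FiniteModelTheory.nonThreeColClass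

/-- item stmt-PneNP-19512 · crux · rank 3 · open · by planner
why it might fail: Dominated by NP ≠ coNP (NP ≠ coNP ⇒ 𝒩 ∉ ∃SO by Fagin1993 Thm 5.3 ⇒ R): summit-strength, declared residual; the binary rung (one extra binary relation, arbitrary FO part) has had no technique since 1975 (DurandLautemannSchwentick1998 §7).
sources: Fagin1993, Fagin1974, DurandLautemannSchwentick1998, arXiv:0907.5495
[crux] RESIDUAL (declared T1′ complement, not claimed attackable): if 𝒩 escapes ESO(∃*∀∃∀) then 𝒩 is
not a generalized spectrum about graphs at all — for every list of witness arities no ∃SO sentence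
defines 𝒩 (negative answer to Fagin's generalized Asser problem, Fagin1993 p.12); contrapositively
NP = coNP ⇒ 𝒩 ∈ ESO(∃*∀∃∀). [deps: NonThreeColNotAEA] [difficulty: open-problem] -/
@[route_item "route-PneNP-NonThreeColCutRectangles", crux]
def PrefixClimb : Prop :=
  (¬ Literature.ModelTheory.FiniteModelTheory.IsPrefixDefinable [2] [Literature.ModelTheory.FiniteModelTheory.FOQuant.all, Literature.ModelTheory.FiniteModelTheory.FOQuant.ex, Literature.ModelTheory.FiniteModelTheory.FOQuant.all] Literature.ModelTheory.FiniteModelTheory.nonThreeColClass) → ¬ Literature.ModelTheory.FiniteModelTheory.IsESODefinable [2] Literature.ModelTheory.FiniteModelTheory.nonThreeColClass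

/-- item stmt-PneNP-19513 · assembly · rank 1 · open · by planner
sources: Fagin1993, Fagin1974
[assembly] NonThreeColNotAEA → PrefixClimb → PneNP (𝒩 ∉ ∃SO ⇒ NP ≠ coNP ⇒ P ≠ NP ⇒ the Wave-0 shape;
proved in glue.lean and used by `closes`). -/
@[route_item "route-PneNP-NonThreeColCutRectangles"]
def Assembly : Prop :=
  NonThreeColNotAEA → PrefixClimb → PneNP

/-! D-0027 §2.1 — DECIDING THEOREM (planner-authored via `route open/edit --closes-file`; by planner-type-764967f429-0 2026-08-17T18:42:34Z):
its hypotheses are this route's items and its conclusion the sub-problem Statement (glue_lint), and it elaborates with this file. -/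

@[closes "route-PneNP-NonThreeColCutRectangles"] theorem closes (h₁ : NonThreeColNotAEA) (h₂ : PrefixClimb) : PneNP := by
  have hA : Assembly := by
    intro h₁ h₂
    refine Literature.Computability.Complexity.pneNP_shape_of_P_ne_NP ?_
    intro hPNP
    apply Literature.ModelTheory.FiniteModelTheory.NP_ne_coNP_of_not_isESODefinable_nonThreeColClass
      (h₂ h₁)
    show Literature.Computability.Complexity.Nondeterministic.NP =
      Literature.Computability.Complexity.co Literature.Computability.Complexity.Nondeterministic.NP
    rw [← hPNP]
    exact Literature.Computability.Complexity.co_P_holds.symm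
  exact hA h₁ h₂

end Summit.PneNP.PneNP.Theses.NonThreeColCutRectangles
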